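import Summits.CriticalPhenomena.PercolationContinuityZ3.Theorems.Transplant.PlanarSkeletonDefs
import Summits.CriticalPhenomena.PercolationContinuityZ3.Theorems.Transplant.BoxProdZ2SeedGeom
import HarnessLib

/-!
# Prisms at any centre of a planar skeleton: FRAME IMAGES OF PRISMS ARE PRISMS (exactly — no shear), the lifted point group fixes
# symmetric prisms, prisms sit inside root-centred windows by the triangle inequality, planar ℓ^∞-gap separation forbids `G`-edges,
# and outward unit steps reach every column at planar ℓ¹ cost (lane memo `HOME/SHEAR-SCOPE.md` §p3, 3.0–3.3; VERDICTS V83)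

builds on p205010 (kernel theorem, internal audit signed; external expert review pending) — nothing in this file uses p205010.
Lane `prim-bschramm`, seat `prim-bschramm-p3` (gen 4; lead order 2026-08-20T17:19:25Z (5) / 17:41:00Z, general-node design of record
"generic windows, fibre depth `d_G(w₀, ·)`"); helper file (`--supports stmt-CriticalPhenomena-4575 --as helper`).  Everything here is
over the BARE `PlanarSkeleton G` of `PlanarSkeletonDefs` (fields `φ`, `lip`, `types`, `frame`, `point`); the windows `Win P R =
{g : φ g ∈ P, d_G(w₀, g) ≤ R}` of the companion interface file (seat `prim-bschramm-stmt`, `PlanarSkeletonConcDefs`) are met here only as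
the set `{g ∈ B_G(w₀, R) | φ g ∈ P}`, so the two files are independent.
* §1 `prismAt c L A = B_G(c, L) ∩ φ⁻¹(φ c + A)` (`prism t R ℓ = prismAt t R Λ_ℓ`), monotone, finite, centred;
  **`image_prismAt_of_frame`** — an automorphism `α` with `α t = c`, `φ ∘ α = φ + (φ c − φ t)` (a FRAME) maps `prismAt t L A` ONTO
  `prismAt c L A`; `exists_frame_image_prismAt` (every prism is a frame image of a base prism); **`image_prismAt_of_point`** (an automorphism
  fixing `t` and acting on `φ − φ t` by `sp g` fixes every `sp g`-symmetric prism at `t` — the habitat of the square-root trick);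
* §2 `abs_sub_le_of_mem_graphBall` (`|φ g i − φ w₀ i| ≤ d_G(w₀, g)`: planar travel is priced into graph distance) and
  **`prismAt_subset_ballWindow`** (`c ∈ B(w₀, R₀)`, `R₀ + L ≤ R`, `φ c + A ⊆ P` ⇒ `prismAt c L A ⊆ {g ∈ B(w₀, R) | φ g ∈ P}` — the generic
  form of every "input region ⊆ window" containment `d_X(w₀, c.1) + L ≤ R` of the `X □ ℤ²` instance);
* §3 `SepInf A B` (planar ℓ^∞-gap `≥ 2`) and **`ne_not_adj_of_sepInf`** (then no common vertex and no `G`-edge between `φ⁻¹ A` and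
  `φ⁻¹ B`, from `lip` alone — the generic twin of `sep_prodR`/`not_adj_of_sep` once the between-boxes are narrowed by one, ruling (A2));
* §4 **`exists_mem_graphBall_φ_eq`** — under outward unit steps (the field `step` of the interface, taken here as a hypothesis of the
  same shape) every planar point `y` is `φ g` for some `g ∈ B_G(w₀, ‖y − φ w₀‖₁)` (the column fact `col_Q` for root-centred windows).
[cite: KozmaNitzan2024, §4 p. 15 (boxes), p. 20 ((22)–(23): lattice symmetries place the local objects), p. 21 (v(P) + Λ_M ⊆ S), p. 26 ((29))]
-/

noncomputable section

namespace Summit.CriticalPhenomena.PercolationContinuityZ3.Theorems.Transplant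

namespace PlanarSkeleton

open Literature.Probability.Percolation Literature.Probability.LatticeModels SimpleGraph
open Literature.Probability.Percolation.GM
open Literature.Barriers.CriticalPhenomena (graphBall graphBall_finite mem_graphBall_self graphBall_mono mem_graphBall_map)
open BoxProdZ2 (mem_graphBall_add)

variable {V : Type} {G : SimpleGraph V} (Φ : PlanarSkeleton G)

/-! ## §1 Prisms at any centre; frame and point-group images -/

/-- **The prism of radius `L` at `c` over the relative planar set `A`**: `B_G(c, L) ∩ φ⁻¹(φ c + A)` (the skeleton's `prism t R ℓ` is the
case `A = Λ_ℓ`). [cite: KozmaNitzan2024, §4 p. 15 (boxes)] -/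
def prismAt (c : V) (L : ℕ) (A : Set (Site 2)) : Set V := {g | g ∈ graphBall G c L ∧ Φ.φ g - Φ.φ c ∈ A}

/-- Membership in a prism. [folklore] -/
@[simp] theorem mem_prismAt {c : V} {L : ℕ} {A : Set (Site 2)} {g : V} :
    g ∈ Φ.prismAt c L A ↔ g ∈ graphBall G c L ∧ Φ.φ g - Φ.φ c ∈ A :=
  Iff.rfl

/-- The skeleton's prisms are the prisms over planar boxes. [folklore] -/
theorem prism_eq_prismAt (t : V) (R ℓ : ℕ) : Φ.prism t R ℓ = Φ.prismAt t R ↑(box 2 ℓ) := by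
  ext g; simp [PlanarSkeleton.prism, prismAt]

/-- Prisms grow with the radius and the planar set. [folklore] -/
theorem prismAt_mono (c : V) {L L' : ℕ} (hL : L ≤ L') {A A' : Set (Site 2)} (hA : A ⊆ A') : Φ.prismAt c L A ⊆ Φ.prismAt c L' A' :=
  fun _ hg => ⟨graphBall_mono G c hL hg.1, hA hg.2⟩

/-- Prisms are finite in a locally finite graph. [folklore] -/
theorem prismAt_finite [G.LocallyFinite] (c : V) (L : ℕ) (A : Set (Site 2)) : (Φ.prismAt c L A).Finite :=
  (graphBall_finite G c L).subset fun _ hg => hg.1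

/-- The centre lies in its prisms over sets containing `0`. [folklore] -/
theorem self_mem_prismAt (c : V) (L : ℕ) {A : Set (Site 2)} (hA : (0 : Site 2) ∈ A) : c ∈ Φ.prismAt c L A :=
  ⟨mem_graphBall_self G c L, by rw [sub_self]; exact hA⟩

/-- **Frame images of prisms are prisms — exactly.**  If the automorphism `α` carries `t` to `c` and translates the skeleton by
`φ c − φ t` (a FRAME of the skeleton), then `α(prismAt t L A) = prismAt c L A`: no shear term, whatever the group law behind `α`
(graph balls go to graph balls, relative skeleton coordinates are preserved).
[cite: KozmaNitzan2024, §4 p. 20 ((22)–(23): the lattice symmetries place the local objects)] -/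
theorem image_prismAt_of_frame {α : G ≃g G} {t c : V} (hαt : α t = c) (hφ : ∀ w, Φ.φ (α w) = Φ.φ w + (Φ.φ c - Φ.φ t)) (L : ℕ)
    (A : Set (Site 2)) : α '' Φ.prismAt t L A = Φ.prismAt c L A := by
  ext g
  constructor
  · rintro ⟨w, ⟨hwB, hwA⟩, rfl⟩
    refine ⟨?_, ?_⟩
    · rw [← hαt]; exact mem_graphBall_map α hwB
    · rw [hφ w]; convert hwA using 1; abel
  · rintro ⟨hgB, hgA⟩
    refine ⟨α.symm g, ⟨?_, ?_⟩, RelIso.apply_symm_apply α g⟩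
    · have h := mem_graphBall_map α.symm hgB
      rwa [← hαt, RelIso.symm_apply_apply] at h
    · have h := hφ (α.symm g)
      rw [RelIso.apply_symm_apply] at h
      have h' : Φ.φ (α.symm g) - Φ.φ t = Φ.φ g - Φ.φ c := by rw [h]; abel
      rw [h']; exact hgA

/-- **Every prism is the frame image of a prism at a base vertex** (field `frame`): type-uniformity of every input probability.
[cite: KozmaNitzan2024, §4 p. 20 ((22)–(23))] -/
theorem exists_frame_image_prismAt (c : V) (L : ℕ) (A : Set (Site 2)) :
    ∃ t ∈ Φ.types, ∃ α : G ≃g G, α t = c ∧ α '' Φ.prismAt t L A = Φ.prismAt c L A := by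
  obtain ⟨t, ht, α, hαt, hφ⟩ := Φ.frame c
  exact ⟨t, ht, α, hαt, Φ.image_prismAt_of_frame hαt hφ L A⟩

/-- **The lifted point group fixes symmetric prisms at a base vertex**: if `α` fixes `t` and acts on `φ − φ t` by `sp g`, and `A` is
`sp g`-invariant, then `α(prismAt t L A) = prismAt t L A`. [cite: KozmaNitzan2024, §4 p. 20 ((22)–(23))] -/
theorem image_prismAt_of_point {α : G ≃g G} {t : V} (hαt : α t = t) {g : HOct 2}
    (hφ : ∀ w, Φ.φ (α w) - Φ.φ t = sp g (Φ.φ w - Φ.φ t)) (L : ℕ) {A : Set (Site 2)} (hA : ∀ y, sp g y ∈ A ↔ y ∈ A) :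
    α '' Φ.prismAt t L A = Φ.prismAt t L A := by
  ext x
  constructor
  · rintro ⟨w, ⟨hwB, hwA⟩, rfl⟩
    refine ⟨?_, ?_⟩
    · have h := mem_graphBall_map α hwB; rwa [hαt] at h
    · rw [hφ w]; exact (hA _).2 hwA
  · rintro ⟨hxB, hxA⟩
    refine ⟨α.symm x, ⟨?_, ?_⟩, RelIso.apply_symm_apply α x⟩
    · have h := mem_graphBall_map α.symm hxB
      have ht : α.symm t = t := by
        have := congrArg α.symm hαt; rw [RelIso.symm_apply_apply] at this; exact this.symm
      rwa [ht] at h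
    · have h := hφ (α.symm x)
      rw [RelIso.apply_symm_apply] at h
      rw [← hA, ← h]; exact hxA

/-- At every base vertex and for every `g ∈ HOct 2` some automorphism fixes every `sp g`-symmetric prism there (field `point`).
[cite: KozmaNitzan2024, §4 p. 20 ((22)–(23))] -/
theorem exists_point_image_prismAt {t : V} (ht : t ∈ Φ.types) (g : HOct 2) (L : ℕ) {A : Set (Site 2)}
    (hA : ∀ y, sp g y ∈ A ↔ y ∈ A) :
    ∃ α : G ≃g G, α t = t ∧ (∀ w, Φ.φ (α w) - Φ.φ t = sp g (Φ.φ w - Φ.φ t)) ∧ α '' Φ.prismAt t L A = Φ.prismAt t L A := by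
  obtain ⟨α, hαt, hφ⟩ := Φ.point t ht g
  exact ⟨α, hαt, hφ, Φ.image_prismAt_of_point hαt hφ L hA⟩

/-! ## §2 Planar travel is priced into graph distance; prisms inside root-centred windows -/

/-- Along a walk the skeleton coordinate moves by at most the length: `|φ b i − φ a i| ≤ |q|`. [folklore] -/
theorem abs_sub_le_length {a b : V} (q : G.Walk a b) (i : Fin 2) : |Φ.φ b i - Φ.φ a i| ≤ q.length := by
  induction q with
  | nil => simp
  | @cons a c b hac q ih =>
    rw [SimpleGraph.Walk.length_cons, Nat.cast_add, Nat.cast_one]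
    have h1 := Φ.lip hac i
    rw [abs_le] at h1 ih ⊢
    constructor <;> linarith [h1.1, h1.2, ih.1, ih.2]

/-- **The skeleton coordinate of a vertex of `B_G(w₀, R)` is within `R` of the root's**: `|φ g i − φ w₀ i| ≤ R` — root-centred windows
over far planar footprints are empty unless the radius dominates the planar offset (the DRIFT of SHEAR-SCOPE §3.0 item 2). [folklore] -/
theorem abs_sub_le_of_mem_graphBall {w₀ g : V} {R : ℕ} (hg : g ∈ graphBall G w₀ R) (i : Fin 2) : |Φ.φ g i - Φ.φ w₀ i| ≤ R := by
  obtain ⟨p, hp⟩ := hg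
  exact (Φ.abs_sub_le_length p i).trans (by exact_mod_cast hp)

/-- **Prisms sit inside root-centred windows by the triangle inequality**: a centre at graph distance `≤ R₀` from the root, `R₀ + L ≤ R`,
and a relative planar set landing in the footprint `P` give `prismAt c L A ⊆ {g ∈ B_G(w₀, R) | φ g ∈ P}`.
[cite: KozmaNitzan2024, §4 p. 21 (v(P) + Λ_M ⊆ S)] -/
theorem prismAt_subset_ballWindow {w₀ c : V} {R₀ L R : ℕ} (hc : c ∈ graphBall G w₀ R₀) (hR : R₀ + L ≤ R) {A : Set (Site 2)}
    {P : Set (Site 2)} (hA : ∀ y ∈ A, Φ.φ c + y ∈ P) : Φ.prismAt c L A ⊆ {g | g ∈ graphBall G w₀ R ∧ Φ.φ g ∈ P} := by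
  intro g hg
  refine ⟨graphBall_mono G w₀ hR (mem_graphBall_add G hc hg.1), ?_⟩
  have h := hA _ hg.2
  rwa [add_sub_cancel] at h

/-- A vertex of a prism of radius `L` about a centre at depth `≤ R₀` has depth `≤ R₀ + L` (contacts found inside a window of radius `R₀`
place their kits inside radius `R₀ + L`). [folklore] -/
theorem mem_graphBall_of_mem_prismAt {w₀ c : V} {R₀ L : ℕ} (hc : c ∈ graphBall G w₀ R₀) {A : Set (Site 2)} {g : V}
    (hg : g ∈ Φ.prismAt c L A) : g ∈ graphBall G w₀ (R₀ + L) :=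
  mem_graphBall_add G hc hg.1

/-! ## §3 Planar ℓ^∞-gap separation forbids edges of `G` -/

/-- **ℓ^∞-gap separation** of two planar sets: every pair of points differs by at least `2` in some coordinate (all of Kozma–Nitzan's
no-edge separations (29)/(31) have this form once the between-boxes are narrowed by one lattice unit, ruling (A2)).
[cite: KozmaNitzan2024, §4 p. 26 ((29)), p. 31 ((31))] -/
def SepInf (A B : Set (Site 2)) : Prop := ∀ y ∈ A, ∀ z ∈ B, ∃ i : Fin 2, (2 : ℤ) ≤ |y i - z i|

omit Φ in
/-- `SepInf` is symmetric. [folklore] -/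
theorem SepInf.symm {A B : Set (Site 2)} (h : SepInf A B) : SepInf B A := by
  intro z hz y hy
  obtain ⟨i, hi⟩ := h y hy z hz
  exact ⟨i, by rwa [abs_sub_comm]⟩

omit Φ in
/-- `SepInf` is monotone under shrinking either set. [folklore] -/
theorem SepInf.mono {A B A' B' : Set (Site 2)} (h : SepInf A B) (hA : A' ⊆ A) (hB : B' ⊆ B) : SepInf A' B' :=
  fun y hy z hz => h y (hA hy) z (hB hz)

/-- **The separation lift from `lip` alone**: vertices projecting into ℓ^∞-gap-separated planar sets are distinct and NOT adjacent in `G`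
(generic twin of `sep_prodR` / `not_adj_of_sep`, valid for skeletons with diagonal edges such as fcc/bcc).
[cite: KozmaNitzan2024, §4 p. 26 ((29)), p. 31 ((31))] -/
theorem ne_not_adj_of_sepInf {A B : Set (Site 2)} (h : SepInf A B) {a b : V} (ha : Φ.φ a ∈ A) (hb : Φ.φ b ∈ B) :
    a ≠ b ∧ ¬G.Adj a b := by
  obtain ⟨i, hi⟩ := h _ ha _ hb
  refine ⟨fun hab => ?_, fun hadj => ?_⟩
  · rw [hab, sub_self, abs_zero] at hi; exact absurd hi (by norm_num)
  · have h1 := Φ.lip hadj i; linarith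

/-- The same for finite vertex sets cut out by planar footprints (the shape `QSepGeom` / `LevelGeom` consume: `∀ a ∈ X, ∀ b ∈ Y, a ≠ b ∧
¬G.Adj a b`). [folklore] -/
theorem sep_of_sepInf {A B : Set (Site 2)} (h : SepInf A B) {X Y : Finset V} (hX : ∀ a ∈ X, Φ.φ a ∈ A) (hY : ∀ b ∈ Y, Φ.φ b ∈ B) :
    ∀ a ∈ X, ∀ b ∈ Y, a ≠ b ∧ ¬G.Adj a b :=
  fun a ha b hb => Φ.ne_not_adj_of_sepInf h (hX a ha) (hY b hb)

/-! ## §4 Outward unit steps reach every column at planar ℓ¹ cost -/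

/-- **Columns are reachable at planar cost**: if at every vertex, for every axis and sign, some neighbour moves the skeleton coordinate by
exactly that unit vector (the field `step` of the interface `PlanarSkeletonConc`), then every planar point `y` is the projection of a vertex at
graph distance `≤ |y 0 − φ w₀ 0| + |y 1 − φ w₀ 1|` from the root (the column fact `col_Q` of `SepGeom` for root-centred windows whose radius
dominates the planar offset). [cite: KozmaNitzan2024, §4 p. 26 ((29): the column of x inside Q_x)] -/
theorem exists_mem_graphBall_φ_eq (hS : ∀ (v : V) (i : Fin 2) (σ : ℤˣ), ∃ v' : V, G.Adj v v' ∧ Φ.φ v' = Φ.φ v + Pi.single i (σ : ℤ))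
    (w₀ : V) (y : Site 2) : ∃ g, g ∈ graphBall G w₀ ((y 0 - Φ.φ w₀ 0).natAbs + (y 1 - Φ.φ w₀ 1).natAbs) ∧ Φ.φ g = y := by
  -- induction on the ℓ¹ distance `n`
  suffices h : ∀ (n : ℕ) (y : Site 2), (y 0 - Φ.φ w₀ 0).natAbs + (y 1 - Φ.φ w₀ 1).natAbs = n →
      ∃ g, g ∈ graphBall G w₀ n ∧ Φ.φ g = y from h _ y rfl
  intro n
  induction n with
  | zero =>
    intro y hy
    refine ⟨w₀, mem_graphBall_self G w₀ 0, ?_⟩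
    have h0 : (y 0 - Φ.φ w₀ 0).natAbs = 0 := by omega
    have h1 : (y 1 - Φ.φ w₀ 1).natAbs = 0 := by omega
    funext i
    fin_cases i
    · exact (sub_eq_zero.1 (Int.natAbs_eq_zero.1 h0)).symm
    · exact (sub_eq_zero.1 (Int.natAbs_eq_zero.1 h1)).symm
  | succ n ih =>
    intro y hy
    -- a coordinate `i` with `y i ≠ φ w₀ i`; step back towards the root in that coordinate
    have hex : ∃ i : Fin 2, y i ≠ Φ.φ w₀ i := by
      by_contra hcon
      push Not at hcon
      have := hcon 0; have := hcon 1
      simp_all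
    obtain ⟨i, hi⟩ := hex
    -- the sign of the last step
    set σ : ℤˣ := if Φ.φ w₀ i < y i then 1 else -1 with hσdef
    set y' : Site 2 := y - Pi.single i (σ : ℤ) with hy'def
    have hy'i : y' i = y i - (σ : ℤ) := by simp [hy'def]
    have hy'j : ∀ j, j ≠ i → y' j = y j := by intro j hj; simp [hy'def, hj]
    have hdist : (y' 0 - Φ.φ w₀ 0).natAbs + (y' 1 - Φ.φ w₀ 1).natAbs = n := by
      have key : (y' i - Φ.φ w₀ i).natAbs + 1 = (y i - Φ.φ w₀ i).natAbs := by
        rw [hy'i]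
        by_cases hlt : Φ.φ w₀ i < y i
        · have : (σ : ℤ) = 1 := by rw [hσdef, if_pos hlt]; rfl
          rw [this]; omega
        · have : (σ : ℤ) = -1 := by rw [hσdef, if_neg hlt]; rfl
          rw [this]
          have hgt : y i < Φ.φ w₀ i := lt_of_le_of_ne (not_lt.1 hlt) hi
          omega
      fin_cases i
      · have h1 := hy'j 1 (by decide)
        simp only [Fin.zero_eta] at key
        rw [h1]; omega
      · have h0 := hy'j 0 (by decide)
        simp only [Fin.mk_one] at key
        rw [h0]; omega
    obtain ⟨g', hg', hφg'⟩ := ih y' hdist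
    obtain ⟨g, hadj, hφg⟩ := hS g' i σ
    refine ⟨g, BoxProdZ2.mem_graphBall_succ_of_adj G hg' hadj, ?_⟩
    rw [hφg, hφg', hy'def, sub_add_cancel]

/-- **The column fact for root-centred windows**: under outward unit steps the column `φ⁻¹(y)` meets `{g ∈ B_G(w₀, R) | φ g ∈ P}` as soon as
`y ∈ P` and `R` dominates the planar ℓ¹-offset of `y` (generic twin of `SepGeom.col_Q`). [cite: KozmaNitzan2024, §4 p. 26 ((29))] -/
theorem exists_mem_ballWindow_φ_eq (hS : ∀ (v : V) (i : Fin 2) (σ : ℤˣ), ∃ v' : V, G.Adj v v' ∧ Φ.φ v' = Φ.φ v + Pi.single i (σ : ℤ))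
    (w₀ : V) {P : Set (Site 2)} {y : Site 2} (hy : y ∈ P) {R : ℕ} (hR : (y 0 - Φ.φ w₀ 0).natAbs + (y 1 - Φ.φ w₀ 1).natAbs ≤ R) :
    ∃ g, (g ∈ graphBall G w₀ R ∧ Φ.φ g ∈ P) ∧ Φ.φ g = y := by
  obtain ⟨g, hg, hφ⟩ := Φ.exists_mem_graphBall_φ_eq hS w₀ y
  exact ⟨g, ⟨graphBall_mono G w₀ hR hg, hφ ▸ hy⟩, hφ⟩

end PlanarSkeleton

end Summit.CriticalPhenomena.PercolationContinuityZ3.Theorems.Transplant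

end
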